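import Literature.Analysis.FunctionSpaces.LatticeChainFourier
import Mathlib.MeasureTheory.Constructions.Pi
import HarnessLib

/-!
# The Fourier transform of a lattice segment: `|1̂_seg(x)| = |D_T(x_j)|` and `∫_T |D_T|² = T`

Analysis/FunctionSpaces support file (module "P3b", first part) for the lattice potential theory of
`ℤ^d` (proof programme of the named fact
`Literature.MathematicalPhysics.QuantumFieldTheory.FrohlichSpencerU1PerimeterLawD4`,
Fröhlich–Spencer 1982 (2.88)): the indicator of a straight segment of `T` sites in direction `j`,
`segInd y₀ j T`, has Fourier transform `e_{y₀}(x) · D_T(x_j)` with the one-variable Dirichlet-type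
kernel `D_T(τ) = ∑_{t<T} 𝐞(tτ)` (`dirichletSum`), so that `‖1̂_seg(x)‖ = ‖D_T(x_j)‖`
(`norm_latFT_segInd`), and `∫_T ‖D_T‖² = T` (`lintegral_enorm_sq_dirichletSum`, by Plancherel on
the `1`-torus and the marginal `x ↦ x_0`). These feed the Fubini bound of `LatticeSegmentEnergy`
(`φ = ‖D_T‖²`): the Coulomb self-energy of one side of a Wilson loop is `≤ 4 C₃ T`.
Everything is proved; no named fact is introduced.

## References

* J. Fröhlich, T. Spencer, Comm. Math. Phys. 83 (1982) 411–454, §2.10 (2.88). [FrohlichSpencerCMP1982]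
-/

noncomputable section

open MeasureTheory Set Filter Complex Finset Function
open scoped Real ENNReal

namespace Literature.Analysis.FunctionSpaces

namespace LatticeFourier

variable {d : ℕ}

/-! ### Segments and their Fourier transforms -/

/-- The sites `y₀ + t eⱼ`, `t < T`, of the straight segment of `T` sites in direction `j`. [folklore] -/
def segSites (y₀ : Fin d → ℤ) (j : Fin d) (T : ℕ) : Finset (Fin d → ℤ) :=
  (Finset.range T).image fun t : ℕ => y₀ + (t : ℤ) • e j

/-- The parametrisation of a segment is injective. [folklore] -/
theorem segSites_map_injective (y₀ : Fin d → ℤ) (j : Fin d) :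
    Function.Injective fun t : ℕ => y₀ + (t : ℤ) • e j := by
  intro t t' h
  have := congrFun h j
  simp only [Pi.add_apply, Pi.smul_apply, Pi.single_eq_same, smul_eq_mul, mul_one,
    add_right_inj, Nat.cast_inj] at this
  exact this

/-- **The indicator of a straight segment** of `T` sites in direction `j` from `y₀`. [folklore] -/
def segInd (y₀ : Fin d → ℤ) (j : Fin d) (T : ℕ) : (Fin d → ℤ) → ℝ :=
  fun y => if y ∈ segSites y₀ j T then 1 else 0

/-- The support of the segment indicator. [folklore] -/
theorem support_segInd (y₀ : Fin d → ℤ) (j : Fin d) (T : ℕ) :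
    Function.support (segInd y₀ j T) ⊆ segSites y₀ j T := by
  intro y hy
  simp only [Function.mem_support, segInd, ne_eq, ite_eq_right_iff, one_ne_zero, imp_false,
    not_not] at hy
  exact hy

/-- The segment indicator has finite support. [folklore] -/
theorem hasFiniteSupport_segInd (y₀ : Fin d → ℤ) (j : Fin d) (T : ℕ) :
    HasFiniteSupport (segInd y₀ j T) :=
  (segSites y₀ j T).finite_toSet.subset (support_segInd y₀ j T)

/-- `∑_y 1_seg(y)² = T`. [folklore] -/
theorem sum_segInd_sq (y₀ : Fin d → ℤ) (j : Fin d) (T : ℕ) :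
    ∑ y ∈ segSites y₀ j T, segInd y₀ j T y ^ 2 = T := by
  have h : ∀ y ∈ segSites y₀ j T, segInd y₀ j T y ^ 2 = 1 := fun y hy => by
    simp [segInd, hy]
  rw [Finset.sum_congr rfl h, Finset.sum_const, nsmul_eq_mul, mul_one, segSites,
    Finset.card_image_of_injective _ (segSites_map_injective y₀ j), Finset.card_range]

/-- **The one-variable Dirichlet-type kernel** `D_T(τ) = ∑_{t<T} 𝐞(tτ)`. [folklore] -/
def dirichletSum (T : ℕ) (τ : UnitAddCircle) : ℂ := ∑ t ∈ Finset.range T, fourier (t : ℤ) τ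

/-- `D_T` is continuous. [folklore] -/
theorem continuous_dirichletSum (T : ℕ) : Continuous (dirichletSum T) := by
  unfold dirichletSum
  exact continuous_finsetSum _ fun t _ => (fourier (t : ℤ)).continuous

/-- The character of a multiple of a unit vector: `e_{t eⱼ}(x) = 𝐞(t x_j)`. [folklore] -/
theorem mFourier_smul_single (t : ℤ) (j : Fin d) (x : UnitAddTorus (Fin d)) :
    UnitAddTorus.mFourier (t • e j) x = fourier t (x j) := by
  simp only [UnitAddTorus.mFourier, ContinuousMap.coe_mk]
  rw [← Finset.prod_erase_mul _ _ (Finset.mem_univ j)]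
  have h : ∀ i ∈ Finset.univ.erase j, fourier ((t • e j : Fin d → ℤ) i) (x i) = 1 := by
    intro i hi
    have hij : i ≠ j := Finset.ne_of_mem_erase hi
    simp [hij]
  rw [Finset.prod_congr rfl h, Finset.prod_const_one, one_mul]
  simp

/-- **The Fourier transform of a segment**: `1̂_seg(x) = e_{y₀}(x) D_T(x_j)`. [folklore] -/
theorem latFT_segInd (y₀ : Fin d → ℤ) (j : Fin d) (T : ℕ) (x : UnitAddTorus (Fin d)) :
    latFT (segSites y₀ j T) (segInd y₀ j T) x = UnitAddTorus.mFourier y₀ x * dirichletSum T (x j) := by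
  classical
  rw [latFT_apply, segSites, Finset.sum_image fun t _ t' _ h => segSites_map_injective y₀ j h,
    dirichletSum, Finset.mul_sum]
  refine Finset.sum_congr rfl fun t ht => ?_
  have hmem : y₀ + (t : ℤ) • e j ∈ (Finset.range T).image fun t : ℕ => y₀ + (t : ℤ) • e j :=
    Finset.mem_image_of_mem _ ht
  simp only [segInd, segSites, hmem, if_true, Complex.ofReal_one, mul_one]
  rw [UnitAddTorus.mFourier_add, mFourier_smul_single]

/-- `‖1̂_seg(x)‖ = ‖D_T(x_j)‖`. [folklore] -/
theorem norm_latFT_segInd (y₀ : Fin d → ℤ) (j : Fin d) (T : ℕ) (x : UnitAddTorus (Fin d)) :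
    ‖latFT (segSites y₀ j T) (segInd y₀ j T) x‖ = ‖dirichletSum T (x j)‖ := by
  rw [latFT_segInd, norm_mul]
  have : ‖UnitAddTorus.mFourier y₀ x‖ = 1 := by
    simp only [UnitAddTorus.mFourier, ContinuousMap.coe_mk, norm_prod]
    exact Finset.prod_eq_one fun i _ => by simp
  rw [this, one_mul]

/-! ### `∫_T ‖D_T‖² = T` -/

/-- **Plancherel for the Dirichlet-type kernel**: `∫⁻_T ‖D_T‖ₑ² = T` (via the `1`-torus: the
marginal of `x ↦ x_0` is the circle's volume — the global probability instance of `FlatTorus` —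
and `∫ ‖1̂_seg‖² = ∑ 1_seg² = T`). [folklore] -/
theorem lintegral_enorm_sq_dirichletSum (T : ℕ) :
    ∫⁻ τ : UnitAddCircle, ‖dirichletSum T τ‖ₑ ^ 2 = (T : ℝ≥0∞) := by
  classical
  -- transport to the torus `UnitAddTorus (Fin 1)` along the coordinate `0`
  have hmp : MeasurePreserving (Function.eval (0 : Fin 1)) (volume : Measure (UnitAddTorus (Fin 1)))
      (volume : Measure UnitAddCircle) :=
    measurePreserving_eval (fun _ : Fin 1 => (volume : Measure UnitAddCircle)) 0
  have hmeas : Measurable fun τ : UnitAddCircle => ‖dirichletSum T τ‖ₑ ^ 2 :=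
    (continuous_dirichletSum T).measurable.enorm.pow_const 2
  rw [← hmp.lintegral_comp hmeas]
  simp only [Function.eval]
  -- on the torus this is `∫⁻ ‖1̂_seg‖ₑ²`, an `ofReal` of the Bochner integral
  have hpt : ∀ x : UnitAddTorus (Fin 1), ‖dirichletSum T (x 0)‖ₑ ^ 2 =
      ENNReal.ofReal (‖latFT (segSites (0 : Fin 1 → ℤ) 0 T) (segInd 0 0 T) x‖ ^ 2) := fun x => by
    rw [norm_latFT_segInd, ← ofReal_norm, ← ENNReal.ofReal_pow (norm_nonneg _)]
  simp_rw [hpt]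
  have hint : Integrable (fun x : UnitAddTorus (Fin 1) =>
      ‖latFT (segSites (0 : Fin 1 → ℤ) 0 T) (segInd 0 0 T) x‖ ^ 2) volume :=
    ((continuous_norm.comp (continuous_latFT _ _)).pow 2).integrable_unitAddTorus
  rw [← ofReal_integral_eq_lintegral_ofReal hint (ae_of_all _ fun x => by positivity),
    integral_norm_sq_latFT, sum_segInd_sq]
  simp

end LatticeFourier

end Literature.Analysis.FunctionSpaces
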